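import Summits.Ventures.HodgeRepro2.A2HodgeBigrading
import Summits.Ventures.HodgeRepro2.A2HardLefschetzMain

/-!
# A2HodgeNumbers — the Hodge numbers of the twelve-plane model: `dim hgrading a b = C(n,a)·C(n,b)`

Tier-4 annex of sub-claim A2 (seat p6, cell pub-hodge-repro2); §8(d): uses an L-value-free
non-vanishing device: NO.

Sequel of `A2HodgeBigrading.lean` (the bigrading `(a, b) ↦ hgrading a b` is an internal
direct-sum decomposition of the model `A ι = ⋀ V ι` refining the degree grading).  Here the
pieces are COUNTED: a basis index set `s` of row 90 is the same as a pair `(sA s, sB s)` of plane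
sets (`indexOf`, `sA_indexOf`, `sB_indexOf`, `indexOf_sA_sB`), the bidegree of `s` is
`(|sA s|, |sB s|)` (`bideg_eq`), so

* `card_filter_bideg`: there are `C(n, a) · C(n, b)` basis index sets of bidegree `(a, b)`,
  `n = |ι|`;
* `finrank_hgrading`: `dim hgrading a b = C(n, a) · C(n, b)` — the Hodge numbers `h^{a,b}` of an
  `n`-dimensional abelian variety — with the Hodge symmetry `h^{a,b} = h^{b,a}`
  (`finrank_hgrading_symm`) and the vanishing `hgrading a b = 0` for `a > n` or `b > n`;
* `finrank_grading_eq_sum`: the Vandermonde consistency `C(2n, k) = Σ_{a+b=k} C(n,a) C(n,b)`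
  (`Nat.add_choose_eq`) read as `dim ⋀^k = Σ_{a+b=k} h^{a,b}` against row 102's
  `finrank_grading`;
* the twelve-plane numbers: `h^{2,2} = h^{10,10} = 66² = 4356`, `dim ⋀^4 = C(24, 4) = 10626`.

What stays prose: the identification of the model's bigrading with the Hodge decomposition of
the cohomology of the abelian variety `B` itself (A0.3 (ii)–(iii)).
-/

namespace Summit.Ventures.HodgeRepro2.A2HodgeNumbers

open WeilPlanes WeilIntegral WeilCoproduct WeilDetect A2ModelDuality A2HodgeTypeModel
  A2HodgeBigrading

variable {ι : Type*} [DecidableEq ι] [Fintype ι]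

/-- The planes whose first-kind generator `a_p` lies in the index set `s`. -/
noncomputable def sA (s : Finset (Fin (Fintype.card (Gen ι)))) : Finset ι :=
  Finset.univ.filter fun p => enum (p, false) ∈ s

/-- The planes whose second-kind generator `b_p` lies in the index set `s`. -/
noncomputable def sB (s : Finset (Fin (Fintype.card (Gen ι)))) : Finset ι :=
  Finset.univ.filter fun p => enum (p, true) ∈ s

omit [DecidableEq ι] in
/-- Membership in `sA`. -/
theorem mem_sA {s : Finset (Fin (Fintype.card (Gen ι)))} {p : ι} :
    p ∈ sA s ↔ enum (p, false) ∈ s := by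
  simp [sA]

omit [DecidableEq ι] in
/-- Membership in `sB`. -/
theorem mem_sB {s : Finset (Fin (Fintype.card (Gen ι)))} {p : ι} :
    p ∈ sB s ↔ enum (p, true) ∈ s := by
  simp [sB]

/-- The generator list of `s` is a permutation of the first-kind generators of `sA s` followed
by the second-kind generators of `sB s` (p5's `weilList`). -/
theorem perm_genListOf (s : Finset (Fin (Fintype.card (Gen ι)))) :
    (genListOf s).Perm (weilList (sA s) false ++ weilList (sB s) true) := by
  refine List.perm_of_nodup_nodup_toFinset_eq (A2LamAdjoint.genListOf_nodup s) ?_ ?_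
  · refine List.nodup_append.mpr ⟨nodup_weilList _ _, nodup_weilList _ _, ?_⟩
    intro j hj j' hj' hjj'
    rw [mem_weilList] at hj hj'
    rw [hjj'] at hj
    exact Bool.false_ne_true (hj.2.symm.trans hj'.2)
  · ext j
    obtain ⟨p, b⟩ := j
    cases b <;> simp [mem_genListOf, mem_weilList, mem_sA, mem_sB]

omit [DecidableEq ι] [Fintype ι] in
/-- `weilList P false` has `|P|` generators of the first kind. -/
theorem cA_weilList_false (P : Finset ι) : cA (weilList P false) = P.card := by
  simp only [cA, weilList, List.countP_map]
  exact (List.countP_eq_length.mpr fun a _ => rfl).trans (Finset.length_toList P)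

omit [DecidableEq ι] [Fintype ι] in
/-- `weilList P true` has no generator of the first kind. -/
theorem cA_weilList_true (P : Finset ι) : cA (weilList P true) = 0 := by
  simp only [cA, weilList, List.countP_map]
  exact List.countP_eq_zero.mpr (fun a _ => by simp)

omit [DecidableEq ι] [Fintype ι] in
/-- `weilList P false` has no generator of the second kind. -/
theorem cB_weilList_false (P : Finset ι) : cB (weilList P false) = 0 := by
  simp only [cB, weilList, List.countP_map]
  exact List.countP_eq_zero.mpr (fun a _ => by simp)

omit [DecidableEq ι] [Fintype ι] in
/-- `weilList P true` has `|P|` generators of the second kind. -/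
theorem cB_weilList_true (P : Finset ι) : cB (weilList P true) = P.card := by
  simp only [cB, weilList, List.countP_map]
  exact (List.countP_eq_length.mpr fun a _ => rfl).trans (Finset.length_toList P)

/-- The bidegree of `s` is `(|sA s|, |sB s|)`. -/
theorem bideg_eq (s : Finset (Fin (Fintype.card (Gen ι)))) :
    bideg s = ((sA s).card, (sB s).card) := by
  have hp := perm_genListOf s
  have hA : cA (genListOf s) = cA (weilList (sA s) false ++ weilList (sB s) true) :=
    hp.countP_eq _
  have hB : cB (genListOf s) = cB (weilList (sA s) false ++ weilList (sB s) true) :=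
    hp.countP_eq _
  simp only [bideg]
  rw [hA, hB, cA_append, cB_append, cA_weilList_false, cA_weilList_true, cB_weilList_false,
    cB_weilList_true, add_zero, zero_add]

omit [DecidableEq ι] in
/-- The index set is determined by its two plane sets. -/
theorem sA_sB_injective :
    Function.Injective (fun s : Finset (Fin (Fintype.card (Gen ι))) => (sA s, sB s)) := by
  intro s t hst
  simp only [Prod.mk.injEq] at hst
  ext i
  obtain ⟨j, rfl⟩ := enum.surjective i
  obtain ⟨p, b⟩ := j
  cases b
  · rw [← mem_sA, hst.1, mem_sA]
  · rw [← mem_sB, hst.2, mem_sB]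

/-- The index set with first-kind planes `P` and second-kind planes `Q`. -/
noncomputable def indexOf (P Q : Finset ι) : Finset (Fin (Fintype.card (Gen ι))) :=
  (P.image fun p => enum (p, false)) ∪ (Q.image fun p => enum (p, true))

omit [DecidableEq ι] in
/-- `sA (indexOf P Q) = P`. -/
theorem sA_indexOf (P Q : Finset ι) : sA (indexOf P Q) = P := by
  ext p
  simp [mem_sA, indexOf]

omit [DecidableEq ι] in
/-- `sB (indexOf P Q) = Q`. -/
theorem sB_indexOf (P Q : Finset ι) : sB (indexOf P Q) = Q := by
  ext p
  simp [mem_sB, indexOf]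

omit [DecidableEq ι] in
/-- `indexOf (sA s) (sB s) = s`. -/
theorem indexOf_sA_sB (s : Finset (Fin (Fintype.card (Gen ι)))) : indexOf (sA s) (sB s) = s :=
  sA_sB_injective (by simp only [sA_indexOf, sB_indexOf])

/-- THE COUNT: there are `C(n, a) · C(n, b)` basis index sets of bidegree `(a, b)`, `n = |ι|`. -/
theorem card_filter_bideg (a b : ℕ) :
    (Finset.univ.filter fun s : Finset (Fin (Fintype.card (Gen ι))) => bideg s = (a, b)).card =
      (Fintype.card ι).choose a * (Fintype.card ι).choose b := by
  have hc := Finset.card_product (Finset.powersetCard a (Finset.univ : Finset ι))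
    (Finset.powersetCard b (Finset.univ : Finset ι))
  rw [Finset.card_powersetCard, Finset.card_powersetCard, Finset.card_univ] at hc
  rw [← hc]
  refine Finset.card_nbij' (fun s => (sA s, sB s)) (fun pq => indexOf pq.1 pq.2) ?_ ?_ ?_ ?_
  · intro s hs
    simp only [Finset.mem_coe, Finset.mem_filter, Finset.mem_univ, true_and] at hs
    rw [bideg_eq, Prod.mk.injEq] at hs
    simp only [Finset.mem_coe, Finset.mem_product, Finset.mem_powersetCard, Finset.subset_univ,
      true_and]
    exact hs
  · rintro ⟨P, Q⟩ hPQ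
    simp only [Finset.mem_coe, Finset.mem_product, Finset.mem_powersetCard, Finset.subset_univ,
      true_and] at hPQ
    simp only [Finset.mem_coe, Finset.mem_filter, Finset.mem_univ, true_and, bideg_eq, sA_indexOf,
      sB_indexOf, hPQ.1, hPQ.2]
  · intro s _
    exact indexOf_sA_sB s
  · rintro ⟨P, Q⟩ _
    simp only [sA_indexOf, sB_indexOf]

/-- THE HODGE NUMBERS OF THE MODEL: `dim hgrading a b = C(n, a) · C(n, b)`, `n = |ι|` — the Hodge
numbers `h^{a,b}` of an `n`-dimensional abelian variety. -/
theorem finrank_hgrading (a b : ℕ) :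
    Module.finrank ℂ (hgrading (ι := ι) a b) =
      (Fintype.card ι).choose a * (Fintype.card ι).choose b := by
  rw [hgrading_eq_span, Set.image_eq_range]
  have hli : LinearIndependent ℂ (fun s : {s : Finset (Fin (Fintype.card (Gen ι))) // s ∈ {s | bideg s = (a, b)}} => aBasis (s : Finset (Fin (Fintype.card (Gen ι))))) :=
    aBasis.linearIndependent.comp _ Subtype.val_injective
  rw [finrank_span_eq_card hli, ← card_filter_bideg a b, Fintype.card_subtype]
  congr 1

/-- Hodge symmetry of the model's Hodge numbers: `h^{a,b} = h^{b,a}`. -/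
theorem finrank_hgrading_symm (a b : ℕ) :
    Module.finrank ℂ (hgrading (ι := ι) a b) = Module.finrank ℂ (hgrading (ι := ι) b a) := by
  rw [finrank_hgrading, finrank_hgrading, mul_comm]

/-- THE VANDERMONDE CONSISTENCY: `dim ⋀^k = Σ_{a + b = k} dim hgrading a b`
(`C(2n, k) = Σ_{a+b=k} C(n, a) C(n, b)`, row 102's `finrank_grading` and `Nat.add_choose_eq`). -/
theorem finrank_grading_eq_sum (k : ℕ) :
    Module.finrank ℂ (grading ι k) =
      ∑ ab ∈ Finset.HasAntidiagonal.antidiagonal k, Module.finrank ℂ (hgrading (ι := ι) ab.1 ab.2) := by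
  rw [A2HardLefschetzMain.finrank_grading, two_mul, Nat.add_choose_eq]
  exact Finset.sum_congr rfl fun ab _ => (finrank_hgrading ab.1 ab.2).symm

/-- `hgrading a b = 0` when `a > n`: there are only `n` generators of the first kind. -/
theorem hgrading_eq_bot_of_card_lt_fst {a : ℕ} (h : Fintype.card ι < a) (b : ℕ) :
    (hgrading a b : Submodule ℂ (A ι)) = ⊥ := by
  rw [hgrading_eq_span, Submodule.span_eq_bot]
  rintro x ⟨s, hs, rfl⟩
  rw [Set.mem_setOf_eq, bideg_eq, Prod.mk.injEq] at hs
  exact absurd (hs.1 ▸ Finset.card_le_univ (sA s)) (not_le.mpr h)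

/-- `hgrading a b = 0` when `b > n`: there are only `n` generators of the second kind. -/
theorem hgrading_eq_bot_of_card_lt_snd (a : ℕ) {b : ℕ} (h : Fintype.card ι < b) :
    (hgrading a b : Submodule ℂ (A ι)) = ⊥ := by
  rw [hgrading_eq_span, Submodule.span_eq_bot]
  rintro x ⟨s, hs, rfl⟩
  rw [Set.mem_setOf_eq, bideg_eq, Prod.mk.injEq] at hs
  exact absurd (hs.2 ▸ Finset.card_le_univ (sB s)) (not_le.mpr h)

/-! ### The twelve-plane instance -/

/-- The Hodge numbers of the twelve-plane model: `h^{a,b} = C(12, a) · C(12, b)`. -/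
theorem finrank_hgrading_twelve (a b : ℕ) :
    Module.finrank ℂ (hgrading (ι := A2TwelvePlanes.ι₁₂) a b) =
      Nat.choose 12 a * Nat.choose 12 b := by
  rw [finrank_hgrading, A2TwelvePlanes.card_twelve]

/-- `h^{2,2} = 66² = 4356` in the twelve-plane model (the bidegree of Theorem A's class,
row 121). -/
theorem finrank_hgrading_two_two :
    Module.finrank ℂ (hgrading (ι := A2TwelvePlanes.ι₁₂) 2 2) = 4356 := by
  rw [finrank_hgrading_twelve]
  decide

/-- `h^{10,10} = 66² = 4356` in the twelve-plane model (the bidegree of the surface class `z`). -/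
theorem finrank_hgrading_ten_ten :
    Module.finrank ℂ (hgrading (ι := A2TwelvePlanes.ι₁₂) 10 10) = 4356 := by
  rw [finrank_hgrading_twelve]
  decide

/-- `dim ⋀^4 = C(24, 4) = 10626` in the twelve-plane model. -/
theorem finrank_grading_four_twelve :
    Module.finrank ℂ (grading A2TwelvePlanes.ι₁₂ 4) = 10626 := by
  rw [A2HardLefschetzMain.finrank_grading, A2TwelvePlanes.card_twelve]
  decide

end Summit.Ventures.HodgeRepro2.A2HodgeNumbers
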